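import Mathlib
import Literature.NumberTheory.Transcendental.RoyCriterion
import Literature.NumberTheory.Transcendental.RoyCriterionProofs
import Summits.Schanuel.Schanuel.Theses.RoyCriterion

/-!
# Sketch — crux-ideate stmt-Schanuel-0463 (`RoyThesisTyped`), ideator 3, round 1

First lemmas of the two idea cards (statements must elaborate; proofs optional):

* Card A `torsion-companion-period-sector`: `Chudnovsky1984_thm_7_4_1_i` (named-fact candidate, Chudnovsky 1984
  Ch. 7 Thm 4.1 (i)), `InPeriodSector`, `schanuelTwo_of_periodSector`, `RoyCriterionAt`,
  `royCriterionAt_two_of_periodSector`.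
* Card B `identity-exact-window`: `royHypothesis_vanish_at_identity` (PROVED here), `RoyAdmissibleBelow`
  (+ example, PROVED), `RoyCriterionBelow`, `royHypothesis_exp_below`, `royCriterionBelow_iff_schanuelRank`,
  `royCriterionBelow_iff_royCriterion`.
-/

noncomputable section

open Complex Filter MvPolynomial

namespace Summit.Schanuel.Schanuel.Cruxes.RoyThesisTyped.Sketch

open Literature.NumberTheory.Transcendental

/-! ## Card A — torsion companion / period sector -/

/-- NAMED-FACT CANDIDATE — Chudnovsky 1984 (*Contributions*, AMS Surveys 19), Ch. 7, Thm 4.1 (i)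
(= Thm 1.21 for algebraic invariants): for ANY Weierstrass `℘` (no algebraicity of `g₂, g₃`) with
half-periods `ω₁, ω₂` (his `2ωᵢ` are periods) and any `φ ≠ 0`,
`#{g₂, g₃, ω₁, ω₂, φ, e^{φω₁}, e^{φω₂}} ≥ 2`. With Mathlib's `PeriodPair` (`ω₁, ω₂` a lattice basis)
the half-periods are `ωᵢ/2`. Auxiliary function of the printed proof: `F(z) = P(z, ℘(z), e^{φz})`,
transcendence type `2 + 1/3`. -/
def Chudnovsky1984_thm_7_4_1_i : Prop :=
  ∀ (L : PeriodPair) (φ : ℂ), φ ≠ 0 →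
    (2 : Cardinal) ≤ Algebra.trdeg ℚ ↥(IntermediateField.adjoin ℚ
      ({L.g₂, L.g₃, L.ω₁ / 2, L.ω₂ / 2, φ, cexp (φ * (L.ω₁ / 2)), cexp (φ * (L.ω₂ / 2))} : Set ℂ))

/-- The rank-2 PERIOD SECTOR: `(y₀, y₁)` is an `ℝ`-basis of `ℂ` (i.e. `y₁/y₀ ∉ ℝ`) and the lattice
`ℤy₀ + ℤy₁` has algebraic invariants (equivalently: it is the period lattice of a Weierstrass model
over `ℚ̄`). Closed under `y ↦ d • y`, `d ∈ ℤ ∖ {0}` (invariants scale by `d⁻⁴, d⁻⁶`). -/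
def InPeriodSector (y : Fin 2 → ℂ) : Prop :=
  ∃ L : PeriodPair, L.ω₁ = y 0 ∧ L.ω₂ = y 1 ∧ IsAlgebraic ℚ L.g₂ ∧ IsAlgebraic ℚ L.g₃

/-- Card A, first lemma (target; from the fact with `φ = 2` and "adjoining algebraic elements does
not change `trdeg`"): Schanuel's conjecture in rank 2 holds on the period sector. -/
theorem schanuelTwo_of_periodSector (h : Chudnovsky1984_thm_7_4_1_i) (y : Fin 2 → ℂ)
    (hy : InPeriodSector y) :
    (2 : Cardinal) ≤ Algebra.trdeg ℚ
      ↥(IntermediateField.adjoin ℚ (Set.range y ∪ Set.range (cexp ∘ y))) := by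
  sorry

/-- Roy's Conjecture 2 AT a given tuple `y` (the crux `RoyThesisTyped` is `∀ l y, LinearIndependent ℚ y → RoyCriterionAt y`
up to currying). -/
def RoyCriterionAt {l : ℕ} (y : Fin l → ℂ) : Prop :=
  ∀ α : Fin l → ℂ, (∀ j, α j ≠ 0) → ∀ s₀ s₁ t₀ t₁ u : ℝ, RoyAdmissible s₀ s₁ t₀ t₁ u →
    RoyHypothesis y α s₀ s₁ t₀ t₁ u →
      (l : Cardinal) ≤ Algebra.trdeg ℚ ↥(IntermediateField.adjoin ℚ (Set.range y ∪ Set.range α))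

/-- Sanity: the crux is the conjunction of the pointwise criteria. -/
theorem royCriterion_iff_forall_at (l : ℕ) :
    RoyCriterion l ↔ ∀ y : Fin l → ℂ, LinearIndependent ℚ y → RoyCriterionAt y := by
  constructor
  · intro h y hy α hα s₀ s₁ t₀ t₁ u hadm hhyp
    exact h y α hy hα s₀ s₁ t₀ t₁ u hadm hhyp
  · intro h y α hy hα s₀ s₁ t₀ t₁ u hadm hhyp
    exact h y hy α hα s₀ s₁ t₀ t₁ u hadm hhyp

/-- Card A, crux-side consequence (target): the rank-2 rung of `RoyThesisTyped` on the period sector,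
from the fact + `royThm1BtoA_holds` (Roy 2001 Prop. 3, in tree) + closure of the sector under `d • y`. -/
theorem royCriterionAt_two_of_periodSector (h : Chudnovsky1984_thm_7_4_1_i) (y : Fin 2 → ℂ)
    (hy : InPeriodSector y) : RoyCriterionAt y := by
  sorry

/-! ## Card B — exactness at the identity and the shifted window -/

/-- Card B, first lemma (PROVED): `m = 0` lies in every box and `(0,1) ∈ Γ`, so under `RoyHypothesis`
the jets at the identity are INTEGERS of absolute value `< 1`, i.e. vanish exactly:
`taylorInt k P_N = (D^k P_N)(0,1) = 0` for all `k ≤ N^{s₀}`. The polynomial `P_N` therefore lies in the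
explicit, `(y, α)`-independent Hermite–Padé kernel lattice `Λ_N(⌊N^{s₀}⌋) = ⋂_k ker (taylorInt k)`. -/
theorem royHypothesis_vanish_at_identity {l : ℕ} {y α : Fin l → ℂ} {s₀ s₁ t₀ t₁ u : ℝ}
    (h : RoyHypothesis y α s₀ s₁ t₀ t₁ u) :
    ∀ᶠ N : ℕ in atTop, ∃ P : MvPolynomial (Fin 2) ℤ, P ≠ 0 ∧
      (P.degreeOf 0 : ℝ) ≤ (N : ℝ) ^ t₀ ∧ (P.degreeOf 1 : ℝ) ≤ (N : ℝ) ^ t₁ ∧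
      (mvPolyHeight P : ℝ) ≤ Real.exp N ∧
      (∀ k : ℕ, (k : ℝ) ≤ (N : ℝ) ^ s₀ → taylorInt k P = 0) ∧
      ∀ (k : ℕ) (m : Fin l → ℕ), (k : ℝ) ≤ (N : ℝ) ^ s₀ → (∀ j, (m j : ℝ) ≤ (N : ℝ) ^ s₁) →
        ‖aeval ![∑ j, (m j : ℂ) * y j, ∏ j, α j ^ m j] (royD^[k] P)‖ ≤ Real.exp (-(N : ℝ) ^ u) := by
  filter_upwards [h, eventually_ge_atTop 1] with N hN hN1
  obtain ⟨P, hP0, hd0, hd1, hH, hsmall⟩ := hN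
  refine ⟨P, hP0, hd0, hd1, hH, ?_, hsmall⟩
  intro k hk
  have h0 := hsmall k 0 hk (fun j => by simpa using Real.rpow_nonneg (Nat.cast_nonneg N) s₁)
  simp only [Pi.zero_apply, Nat.cast_zero, zero_mul, Finset.sum_const_zero, pow_zero,
    Finset.prod_const_one] at h0
  have hcast : aeval ![(0 : ℂ), 1] (royD^[k] P) = ((eval ![0, 1] (royD^[k] P) : ℤ) : ℂ) := by
    rw [intCast_eval]
    congr 1
    ext i
    fin_cases i <;> simp
  rw [hcast, Complex.norm_intCast] at h0
  have hlt : |((eval ![0, 1] (royD^[k] P) : ℤ) : ℝ)| < 1 := by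
    refine lt_of_le_of_lt h0 ?_
    rw [Real.exp_lt_one_iff]
    have : (0 : ℝ) < (N : ℝ) ^ u := Real.rpow_pos_of_pos (Nat.cast_pos.mpr hN1) u
    linarith
  have hlt' : |(eval ![0, 1] (royD^[k] P) : ℤ)| < 1 := by exact_mod_cast hlt
  simpa [taylorInt] using Int.abs_lt_one_iff.mp hlt'

/-- Card B: the SHIFTED window `R''` — Prop. 3's window `max(1,t₀,2t₁) < min(s₀,2s₁) < u` together with
`u < s₀` and the Taylor-sufficiency condition `s₁ + t₁ < s₀ < (1+t₀+t₁)/2` (so `min(s₀,2s₁) = 2s₁`). -/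
def RoyAdmissibleBelow (s₀ s₁ t₀ t₁ u : ℝ) : Prop :=
  0 < s₀ ∧ 0 < s₁ ∧ 0 < t₀ ∧ 0 < t₁ ∧ 0 < u ∧
    max 1 (max t₀ (2 * t₁)) < 2 * s₁ ∧ 2 * s₁ < u ∧ u < s₀ ∧ s₁ + t₁ < s₀ ∧ s₀ < (1 + t₀ + t₁) / 2

/-- `R''` is inhabited: `(s₀, s₁, t₀, t₁, u) = (1.24, 0.61, 1.2, 0.3, 1.23)`. -/
theorem royAdmissibleBelow_example : RoyAdmissibleBelow 1.24 0.61 1.2 0.3 1.23 := by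
  refine ⟨by norm_num, by norm_num, by norm_num, by norm_num, by norm_num, ?_, by norm_num,
    by norm_num, by norm_num, by norm_num⟩
  norm_num

/-- Card B transfer target `C⁼`: Roy's Conjecture 2 in the shifted window (hypothesis = membership of
`P_N` in the explicit kernel lattice `Λ_N(⌊N^{s₀}⌋)` + smallness `e^{-N^u}` with `u < s₀` on `Γ(N^{s₁})`). -/
def RoyCriterionBelow (l : ℕ) : Prop :=
  ∀ (y α : Fin l → ℂ), LinearIndependent ℚ y → (∀ j, α j ≠ 0) →
    ∀ (s₀ s₁ t₀ t₁ u : ℝ), RoyAdmissibleBelow s₀ s₁ t₀ t₁ u → RoyHypothesis y α s₀ s₁ t₀ t₁ u →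
      (l : Cardinal) ≤ Algebra.trdeg ℚ ↥(IntermediateField.adjoin ℚ (Set.range y ∪ Set.range α))

/-- Card B, engine of `⇐` (target, M-sized): in `R''` graph points satisfy the hypothesis by Siegel's lemma on
the `⌊N^{s₀'}⌋ + 1` integer Taylor functionals `taylorInt k` for some `s₀ < s₀' < (1+t₀+t₁)/2` (height `e^N`
needs `2s₀' - t₀ - t₁ < 1`) and Taylor's tail + Cauchy's estimate on `|z| ≤ 2c N^{s₁}`
(`log |f^{(k)}(m·y)| ≤ s₀ N^{s₀} log N - (s₀' - s₁ - t₁) N^{s₀'} log N (1 - o(1)) < -N^u` for `k ≤ N^{s₀}`; order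
exactly `N^{s₀}` would NOT control the top derivatives); no Schwarz lemma on a large disc, no Waldschmidt Thm 3
(contrast `exists_royAuxPoly`). -/
theorem royHypothesis_exp_below {l : ℕ} (y : Fin l → ℂ) {s₀ s₁ t₀ t₁ u : ℝ}
    (h : RoyAdmissibleBelow s₀ s₁ t₀ t₁ u) :
    RoyHypothesis y (fun j => cexp (y j)) s₀ s₁ t₀ t₁ u := by
  sorry

/-- Card B transfer (target): the shifted criterion is again equivalent to Schanuel rank by rank —
`⇐` by `royHypothesis_exp_below`, `⇒` by `Roy2001_prop3_holds` (its window `min(s₀,2s₁) = 2s₁ < u` holds in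
`R''`) and Schanuel at `d • y`, exactly as in `royCriterion_of_schanuelRank`. -/
theorem royCriterionBelow_iff_schanuelRank (l : ℕ) : RoyCriterionBelow l ↔ SchanuelRank l := by
  sorry

/-- Hence `C⁼ ⟺ crux rung`, via `Roy2001_iff_holds`. -/
theorem royCriterionBelow_iff_royCriterion (l : ℕ) : RoyCriterionBelow l ↔ RoyCriterion l := by
  rw [royCriterionBelow_iff_schanuelRank]
  exact (Roy2001_iff_holds l).symm

end Summit.Schanuel.Schanuel.Cruxes.RoyThesisTyped.Sketch

end
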